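import Mathlib
import HarnessLib

/-!
# Profiles for the Morse–Bott function of brick F3 (layer `f3_profiles`)

Auxiliary file (layer 1) of stub `helper_sliceGluing_bottConstruction` (apex brick F3: the
construction of the Morse–Bott function `F` and of the angular map `α`), line `Sketch`, crux
`SblfDescent.RungOne`.

(Crux item stmt-SmoothPoincare4-18531; skeleton `Cruxes/RungOne/Lines/Sketch.lean`.)

The function of brick F3 is `F = c₁ P(h) [μ(h) cos δ - (1 - μ(h)) K]` with `h = ⟪f, v⟫` the
height of the fibration, `μ` a smooth monotone plateau and `P` a *profile*: a function of the
height which is strictly decreasing on `[-1, 1]`, affine with a tiny slope `-p₀` on the lower part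
`h ≤ h₁` (this makes the tube analysis about the round circle explicit:
`P(Q) = P(0) - p₀ Q`), and equal to `c √(1 - h²)` near the top `h = 1` (this makes
`P(h) cos δ = c ⟪W, a⟫` smooth at the polar torus fibre, `W` the base coordinate of norm
`√(1 - h²)`).  This file provides, as pure one-variable calculus:

* the smooth monotone step `h ↦ smoothTransition ((h - a) / (b - a))` built from
  `Real.smoothTransition`: `0` on `(-∞, a]`, `1` on `[b, ∞)`, values in `[0, 1]`, monotone with
  derivative `≥ 0` (the plateaus `μ`, `λ` of brick F3 are such steps in the height);
* the registered statement `helper_f3_profile`: for `0 < c`, `0 < h₁ < h₂ < 1`, `0 < p₀` a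
  continuous `P : ℝ → ℝ`, smooth on `(-∞, 1)`, with `P h = c √(1 - h²)` for `h₂ ≤ h`,
  `P h = P₁ - p₀ (h - h₁)` for `h ≤ h₁` (`P₁ ≥ c √(1 - h₁²)`), `P' < 0` and `P > 0` on `(-∞, 1)`,
  strictly decreasing on `(-∞, 1]`.

The construction is `P = χ · c √(1 - h²) + (1 - χ) · (P₁ - p₀ (h - h₁))` with `χ` the step from
`h₁` to `hm = (h₁ + h₂)/2` and `P₁ = c √(1 - h₁²) + p₀ (hm - h₁)`, chosen so that the round part
lies below the affine part where `χ` varies, whence `P' ≤ χ (c √(1 - h²))' - (1 - χ) p₀ < 0`.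

## References

* J. Milnor, *Morse theory*, Ann. of Math. Studies 51 (1963), §2–§3 (auxiliary functions of
  one variable in the manipulation of Morse functions). [Milnor1963]
-/

set_option linter.dupNamespace false

noncomputable section

open scoped ContDiff Topology
open Set Filter

namespace Summit.SmoothPoincare4.SmoothPoincare4.Cruxes.RungOne.Sketch

/-! ### The smooth monotone step -/

section Step

variable {a b : ℝ}

/-- The step `h ↦ smoothTransition ((h - a) / (b - a))` is smooth. [folklore] -/
theorem contDiff_smoothStep (a b : ℝ) :
    ContDiff ℝ ∞ (fun h : ℝ => Real.smoothTransition ((h - a) / (b - a))) :=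
  Real.smoothTransition.contDiff.comp ((contDiff_id.sub contDiff_const).div_const _)

/-- The step vanishes to the left of `a`. [folklore] -/
theorem smoothStep_of_le_left (hab : a < b) {h : ℝ} (h' : h ≤ a) :
    Real.smoothTransition ((h - a) / (b - a)) = 0 :=
  Real.smoothTransition.zero_of_nonpos (div_nonpos_of_nonpos_of_nonneg (by linarith) (by linarith))

/-- The step equals `1` to the right of `b`. [folklore] -/
theorem smoothStep_of_right_le (hab : a < b) {h : ℝ} (h' : b ≤ h) :
    Real.smoothTransition ((h - a) / (b - a)) = 1 :=
  Real.smoothTransition.one_of_one_le ((one_le_div (by linarith)).2 (by linarith))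

/-- The step is monotone. [folklore] -/
theorem monotone_smoothStep (hab : a < b) :
    Monotone (fun h : ℝ => Real.smoothTransition ((h - a) / (b - a))) := fun x y hxy =>
  Real.smoothTransition.monotone (div_le_div_of_nonneg_right (by linarith) (by linarith))

/-- The derivative of the step is nonnegative. [folklore] -/
theorem deriv_smoothStep_nonneg (hab : a < b) (h : ℝ) :
    0 ≤ deriv (fun h : ℝ => Real.smoothTransition ((h - a) / (b - a))) h :=
  (monotone_smoothStep hab).deriv_nonneg

/-- The step is locally constant off `(a, b)`, so its derivative vanishes to the left of `a`.
[folklore] -/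
theorem deriv_smoothStep_of_lt_left (hab : a < b) {h : ℝ} (h' : h < a) :
    deriv (fun h : ℝ => Real.smoothTransition ((h - a) / (b - a))) h = 0 := by
  have : (fun h : ℝ => Real.smoothTransition ((h - a) / (b - a))) =ᶠ[𝓝 h] fun _ => (0 : ℝ) :=
    (eventually_lt_nhds h').mono fun y hy => smoothStep_of_le_left hab hy.le
  rw [this.deriv_eq, deriv_const]

/-- The step is locally constant off `(a, b)`, so its derivative vanishes to the right of `b`.
[folklore] -/
theorem deriv_smoothStep_of_right_lt (hab : a < b) {h : ℝ} (h' : b < h) :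
    deriv (fun h : ℝ => Real.smoothTransition ((h - a) / (b - a))) h = 0 := by
  have : (fun h : ℝ => Real.smoothTransition ((h - a) / (b - a))) =ᶠ[𝓝 h] fun _ => (1 : ℝ) :=
    (eventually_gt_nhds h').mono fun y hy => smoothStep_of_right_le hab hy.le
  rw [this.deriv_eq, deriv_const]

end Step

/-! ### The round part `c √(1 - h²)` -/

/-- The derivative of `c √(1 - h²)` at a point of `(0, 1)` exists and is negative (`0 < c`).
[folklore] -/
theorem exists_hasDerivAt_mul_sqrt_one_sub_sq {c h : ℝ} (hc : 0 < c) (h0 : 0 < h) (h1 : h < 1) :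
    ∃ m < 0, HasDerivAt (fun y : ℝ => c * √(1 - y ^ 2)) m h := by
  have hpos : 0 < 1 - h ^ 2 := by nlinarith
  have hd : HasDerivAt (fun y : ℝ => 1 - y ^ 2) (-(2 * h)) h := by
    simpa using (hasDerivAt_pow 2 h).const_sub 1
  have hs := (Real.hasDerivAt_sqrt hpos.ne').comp h hd
  refine ⟨c * (1 / (2 * √(1 - h ^ 2)) * -(2 * h)), ?_, hs.const_mul c⟩
  have : 0 < √(1 - h ^ 2) := Real.sqrt_pos.2 hpos
  have : 0 < 1 / (2 * √(1 - h ^ 2)) := by positivity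
  nlinarith [mul_pos hc (mul_pos this h0)]

/-- `c √(1 - h²)` is smooth at every point of `(-1, 1)`. [folklore] -/
theorem contDiffAt_mul_sqrt_one_sub_sq (c : ℝ) {h : ℝ} (h0 : -1 < h) (h1 : h < 1) {n : ℕ∞} :
    ContDiffAt ℝ n (fun y : ℝ => c * √(1 - y ^ 2)) h := by
  have hpos : 0 < 1 - h ^ 2 := by nlinarith
  exact contDiffAt_const.mul ((contDiffAt_const.sub (contDiffAt_id.pow 2)).sqrt hpos.ne')

/-! ### The profile -/

/-- **Layer `f3_profiles` of brick F3: the height profile of the Morse–Bott function.**  For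
`0 < c`, `0 < h₁ < h₂ < 1` and a slope `0 < p₀` there is a continuous `P : ℝ → ℝ`, smooth on
`(-∞, 1)`, equal to `c √(1 - h²)` for `h₂ ≤ h` (so that `P(h) cos δ` is smooth at the polar
fibre `h = 1`) and to the affine function `P₁ - p₀ (h - h₁)` for `h ≤ h₁` (so that the tube
analysis about the round circle is explicit), with `P' < 0` and `P > 0` on `(-∞, 1)` and `P`
strictly decreasing on `(-∞, 1]`; `P = χ · c √(1 - h²) + (1 - χ) · (P₁ - p₀ (h - h₁))` for a
smooth step `χ` (auxiliary one-variable functions as in Milnor 1963, §2–§3).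
[cite: Milnor1963, §3] -/
theorem helper_f3_profile : ∀ (c h₁ h₂ p₀ : ℝ), 0 < c → 0 < h₁ → h₁ < h₂ → h₂ < 1 → 0 < p₀ → ∃ (P : ℝ → ℝ) (P₁ : ℝ), Continuous P ∧ ContDiffOn ℝ ∞ P (Set.Iio 1) ∧ (∀ h, h₂ ≤ h → P h = c * √(1 - h ^ 2)) ∧ (∀ h, h ≤ h₁ → P h = P₁ - p₀ * (h - h₁)) ∧ c * √(1 - h₁ ^ 2) ≤ P₁ ∧ (∀ h, h < 1 → deriv P h < 0) ∧ (∀ h, h < 1 → 0 < P h) ∧ StrictAntiOn P (Set.Iic 1) := by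
  intro c h₁ h₂ p₀ hc h1 h12 h2 hp
  -- the transition `[h₁, hm]`, the step `χ`, the two parts `R`, `L` and the base value `P₁`
  set hm : ℝ := (h₁ + h₂) / 2 with hm_def
  have h1m : h₁ < hm := by rw [hm_def]; linarith
  have hm2 : hm < h₂ := by rw [hm_def]; linarith
  set P₁ : ℝ := c * √(1 - h₁ ^ 2) + p₀ * (hm - h₁) with hP₁
  set χ : ℝ → ℝ := fun h => Real.smoothTransition ((h - h₁) / (hm - h₁)) with hχ
  set R : ℝ → ℝ := fun h => c * √(1 - h ^ 2) with hR
  set L : ℝ → ℝ := fun h => P₁ - p₀ * (h - h₁) with hL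
  set P : ℝ → ℝ := fun h => χ h * R h + (1 - χ h) * L h with hP
  have hχs : ContDiff ℝ ∞ χ := contDiff_smoothStep h₁ hm
  have hχ0 : ∀ h, 0 ≤ χ h := fun h => Real.smoothTransition.nonneg _
  have hχ1 : ∀ h, χ h ≤ 1 := fun h => Real.smoothTransition.le_one _
  have hχ' : ∀ h, 0 ≤ deriv χ h := deriv_smoothStep_nonneg h1m
  -- the two plateaus of `P`
  have hP_top : ∀ h, hm ≤ h → P h = c * √(1 - h ^ 2) := fun h hh => by
    simp only [hP, hχ, hR, smoothStep_of_right_le h1m hh]; ring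
  have hP_bot : ∀ h, h ≤ h₁ → P h = P₁ - p₀ * (h - h₁) := fun h hh => by
    simp only [hP, hχ, hL, smoothStep_of_le_left h1m hh]; ring
  have hLd : ∀ h, HasDerivAt L (-p₀) h := fun h => by
    simpa [hL] using ((hasDerivAt_id h).sub_const h₁).const_mul p₀ |>.const_sub P₁
  -- where `χ` varies the round part lies below the affine part
  have hRL : ∀ h, h₁ ≤ h → h ≤ hm → R h - L h ≤ 0 := fun h hh1 hhm => by
    have hs : √(1 - h ^ 2) ≤ √(1 - h₁ ^ 2) := Real.sqrt_le_sqrt (by nlinarith)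
    have : c * √(1 - h ^ 2) ≤ c * √(1 - h₁ ^ 2) := mul_le_mul_of_nonneg_left hs hc.le
    simp only [hR, hL, hP₁]
    nlinarith
  -- continuity
  have hPc : Continuous P := by
    have hRc : Continuous R := by rw [hR]; fun_prop
    have hLc : Continuous L := by rw [hL]; fun_prop
    exact (hχs.continuous.mul hRc).add ((continuous_const.sub hχs.continuous).mul hLc)
  -- smoothness on `(-∞, 1)`
  have hPs : ContDiffOn ℝ ∞ P (Iio 1) := by
    intro h hh
    refine ContDiffAt.contDiffWithinAt ?_
    by_cases hlt : h < h₁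
    · have hev : P =ᶠ[𝓝 h] L := (eventually_lt_nhds hlt).mono fun y hy => hP_bot y hy.le
      refine ContDiffAt.congr_of_eventuallyEq ?_ hev
      rw [hL]; fun_prop
    · have hm1 : -1 < h := by linarith [not_lt.mp hlt]
      have hstep : ContDiffAt ℝ ∞ χ h := hχs.contDiffAt
      have hr : ContDiffAt ℝ ∞ R h := contDiffAt_mul_sqrt_one_sub_sq c hm1 hh
      have ha : ContDiffAt ℝ ∞ L h := by rw [hL]; fun_prop
      exact (hstep.mul hr).add ((contDiffAt_const.sub hstep).mul ha)
  -- negativity of the derivative on `(-∞, 1)`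
  have hPd : ∀ h, h < 1 → deriv P h < 0 := by
    intro h hh
    by_cases hlt : h < h₁
    · have hev : P =ᶠ[𝓝 h] L := (eventually_lt_nhds hlt).mono fun y hy => hP_bot y hy.le
      rw [hev.deriv_eq, (hLd h).deriv]; linarith
    have hh1 : h₁ ≤ h := not_lt.mp hlt
    have h0 : 0 < h := h1.trans_le hh1
    obtain ⟨m, hmneg, hr⟩ := exists_hasDerivAt_mul_sqrt_one_sub_sq hc h0 hh
    by_cases hgt : hm < h
    · have hev : P =ᶠ[𝓝 h] R := (eventually_gt_nhds hgt).mono fun y hy => hP_top y hy.le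
      rw [hev.deriv_eq, hr.deriv]
      exact hmneg
    have hhm : h ≤ hm := not_lt.mp hgt
    have hχd : HasDerivAt χ (deriv χ h) h := ((hχs.differentiable (by simp)) h).hasDerivAt
    have hPh : HasDerivAt P
        (deriv χ h * R h + χ h * m + ((0 - deriv χ h) * L h + (1 - χ h) * -p₀)) h := by
      have h2 : HasDerivAt (fun y => 1 - χ y) (0 - deriv χ h) h := (hasDerivAt_const h 1).sub hχd
      exact (hχd.mul hr).add (h2.mul (hLd h))
    rw [hPh.deriv]
    have key : deriv χ h * R h + (0 - deriv χ h) * L h ≤ 0 := by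
      have : deriv χ h * R h + (0 - deriv χ h) * L h = deriv χ h * (R h - L h) := by ring
      rw [this]
      exact mul_nonpos_of_nonneg_of_nonpos (hχ' h) (hRL h hh1 hhm)
    nlinarith [mul_nonneg (hχ0 h) (neg_nonneg.2 hmneg.le), mul_nonneg (sub_nonneg.2 (hχ1 h)) hp.le,
      hχ0 h, hχ1 h]
  -- positivity on `(-∞, 1)`
  have hsq1 : 0 < √(1 - h₁ ^ 2) := Real.sqrt_pos.2 (by nlinarith)
  have hB : 0 < P₁ := by rw [hP₁]; nlinarith [mul_pos hc hsq1]
  have hPpos : ∀ h, h < 1 → 0 < P h := by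
    intro h hh
    by_cases hle : h ≤ h₁
    · rw [hP_bot h hle]; nlinarith
    have hh1 : h₁ < h := not_le.mp hle
    have hRp : 0 < R h := by
      simp only [hR]
      exact mul_pos hc (Real.sqrt_pos.2 (by nlinarith))
    by_cases hge : hm ≤ h
    · rw [hP_top h hge]; exact hRp
    have hhm : h < hm := not_le.mp hge
    have hLp : 0 < L h := by simp only [hL, hP₁]; nlinarith [mul_pos hc hsq1]
    rcases (hχ0 h).eq_or_lt with h0 | h0
    · simp only [hP]; rw [← h0]; simpa using hLp
    · simp only [hP]
      nlinarith [mul_pos h0 hRp, mul_nonneg (sub_nonneg.2 (hχ1 h)) hLp.le]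
  -- strict decrease on `(-∞, 1]`
  have hPanti : StrictAntiOn P (Iic 1) :=
    strictAntiOn_of_deriv_neg (convex_Iic 1) hPc.continuousOn fun x hx => by
      rw [interior_Iic] at hx
      exact hPd x hx
  refine ⟨P, P₁, hPc, hPs, fun h hh => hP_top h (hm2.le.trans hh), hP_bot, ?_, hPd, hPpos, hPanti⟩
  rw [hP₁]; nlinarith

end Summit.SmoothPoincare4.SmoothPoincare4.Cruxes.RungOne.Sketch

end
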